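import Summits.CriticalPhenomena.CardyFormulaZ2.Theorems.CardyComplexConeSLESixFamiliesGiveCardyDefs
import HarnessLib

/-!
# drefute gen-7 — registered helper `smoothMark_part9` (STUB F, part 9/10): candidate proof + mutation

`smoothMark_part9` (registered 2026-08-16T05:18Z by the lead) is the MIDPOINT INEQUALITY: if the two
endpoints of each edge `s(z i 0, z i 1)` are within `5δ` of the mark `D.pt i`, then the two medial points
(edge midpoints) and the two marks are within Hausdorff distance `5δ`.  The hypotheses
`z i j ∈ zdBoundary`, `Adj`, `¬ (C i (z i 0) ↔ C i (z i 1))` are DECORATION (mutation finding: the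
statement holds with them dropped — `part9_core` below), so the prover may discharge it by
`part9_core` after projecting the distance hypotheses.
-/

noncomputable section

open Set Metric
open Literature.Probability Literature.Probability.RandomPlanarGeometry
  Literature.Probability.LatticeModels

namespace Summit.CriticalPhenomena.CardyFormulaZ2.Cruxes.SLESixFamiliesGiveCardy.CollarTouchSandwich
namespace DrefuteG7

/-- Midpoint inequality: the medial point of `s(x, y)` is within `r` of any point within `r` of both
mesh points. -/
theorem dist_medialPoint_le {δ r : ℝ} {x y : Site 2} {p : ℂ}
    (hx : dist (meshPoint δ x) p ≤ r) (hy : dist (meshPoint δ y) p ≤ r) :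
    dist (medialPoint δ s(x, y)) p ≤ r := by
  rw [medialPoint_mk]
  rw [dist_eq_norm] at hx hy ⊢
  have h : (meshPoint δ x + meshPoint δ y) / 2 - p =
      (1 / 2 : ℂ) * ((meshPoint δ x - p) + (meshPoint δ y - p)) := by ring
  rw [h, norm_mul]
  have h2 : ‖(1 / 2 : ℂ)‖ = 1 / 2 := by simp
  rw [h2]
  have := norm_add_le (meshPoint δ x - p) (meshPoint δ y - p)
  nlinarith

/-- **Core of `smoothMark_part9` with the decorative hypotheses dropped.** -/
theorem part9_core (D : DobrushinDomain) (δ : ℝ) (z : Fin 2 → Fin 2 → Site 2)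
    (h : ∀ i : Fin 2, dist (meshPoint δ (z i 0)) (D.pt i) ≤ 5 * δ ∧
      dist (meshPoint δ (z i 1)) (D.pt i) ≤ 5 * δ) :
    Metric.hausdorffEDist (medialPoint δ '' {s(z 0 0, z 0 1), s(z 1 0, z 1 1)}) {D.pt 0, D.pt 1} ≤
      ENNReal.ofReal (5 * δ) := by
  have hm : ∀ i : Fin 2, dist (medialPoint δ s(z i 0, z i 1)) (D.pt i) ≤ 5 * δ := fun i =>
    dist_medialPoint_le (h i).1 (h i).2
  have h5 : 0 ≤ 5 * δ := le_trans dist_nonneg (hm 0)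
  refine Metric.hausdorffEDist_le_of_mem_edist ?_ ?_
  · rintro _ ⟨e, he, rfl⟩
    rcases he with rfl | rfl
    · exact ⟨D.pt 0, by simp, (edist_le_ofReal h5).2 (hm 0)⟩
    · exact ⟨D.pt 1, by simp, (edist_le_ofReal h5).2 (hm 1)⟩
  · rintro q hq
    rcases hq with rfl | rfl
    · refine ⟨medialPoint δ s(z 0 0, z 0 1), mem_image_of_mem _ (by simp), ?_⟩
      rw [edist_comm]; exact (edist_le_ofReal h5).2 (hm 0)
    · refine ⟨medialPoint δ s(z 1 0, z 1 1), mem_image_of_mem _ (by simp), ?_⟩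
      rw [edist_comm]; exact (edist_le_ofReal h5).2 (hm 1)

/-- **`smoothMark_part9` verbatim (registered signature), as a corollary of `part9_core`.** -/
theorem smoothMark_part9_proof : ∀ (D : DobrushinDomain) (δ : ℝ) (C : Fin 2 → Site 2 → Prop) (z : Fin 2 → Fin 2 → Site 2), (∀ i : Fin 2, z i 0 ∈ (⟨D.carrier, δ, ∅, ∅⟩ : DiscreteDobrushin).zdBoundary ∧ z i 1 ∈ (⟨D.carrier, δ, ∅, ∅⟩ : DiscreteDobrushin).zdBoundary ∧ (discreteDomainGraph D.carrier δ).Adj (z i 0) (z i 1) ∧ dist (meshPoint δ (z i 0)) (D.pt i) ≤ 5 * δ ∧ dist (meshPoint δ (z i 1)) (D.pt i) ≤ 5 * δ ∧ ¬ (C i (z i 0) ↔ C i (z i 1))) → Metric.hausdorffEDist (medialPoint δ '' {s(z 0 0, z 0 1), s(z 1 0, z 1 1)}) {D.pt 0, D.pt 1} ≤ ENNReal.ofReal (5 * δ) :=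
  fun D δ _ z h => part9_core D δ z fun i => ⟨(h i).2.2.2.1, (h i).2.2.2.2.1⟩

end DrefuteG7
end Summit.CriticalPhenomena.CardyFormulaZ2.Cruxes.SLESixFamiliesGiveCardy.CollarTouchSandwich

end
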